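import Literature.NumberTheory.LFunctions.SelbergFujiiSmallGaps
import HarnessLib

/-!
# Selberg–Fujii: the gap second moment (9.25.4)₂ from the mean square of `S(t+h) − S(t)` — proofs

Trunk T-ANT (`Literature/NumberTheory/LFunctions`). Proofs only (no definitions, no named facts).
Fifth file of the Selberg–Fujii cluster (`ZeroGaps.lean`: the named facts
`Literature.NumberTheory.LFunctions.selberg_fujii_large_gaps` (9.25.5) and `…small_gaps` (9.25.6);
`ZeroGapsProofs.lean`: small gaps from large gaps; `SelbergFujiiLargeGaps.lean`: large gaps from
the first-moment bound (9.26.1) and the gap second moment (9.25.4)₂;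
`SelbergFujiiMoments.lean`: (9.26.1) from Fujii's (9.25.2)–(9.25.3)₂;
`SelbergFujiiSmallGaps.lean`: small gaps from (9.26.1) alone, and (9.26.1) from an `L¹` bound).

## Main results

* `Literature.NumberTheory.LFunctions.SelbergFujii.gap_sq_sum_of_meanSquare` — PROVED: the case
  `k = 2` of (9.25.4), `Σ_{0 < γ_n ≤ T} (γ_{n+1} − γ_n)² ≤ C N(T)/log² T` for `T ≥ T₂`, in exactly
  the form taken as hypothesis (`h254`, resp. `h2`) by `selberg_fujii_large_gaps_of_moments`,
  resp. `selberg_fujii_large_gaps_of_first_moment`, follows from the UPPER-BOUND half of Fujii's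
  mean square (9.25.2) in the uniformity `0 ≤ h ≤ 1`:
  `∫_0^T (S(t+h) − S(t))² dt ≤ A T log(3 + h log T)` (`T ≥ T₀`).
* `Literature.NumberTheory.LFunctions.selberg_fujii_large_gaps_of_moments'` — the large-gap
  fact from (9.25.2) and (9.25.3)₂ ONLY: the third hypothesis (9.25.4)₂ of
  `selberg_fujii_large_gaps_of_moments` is now derived from the first
  (`SelbergFujii.meanSquare_le_of_asymptotic`), so the large-gap fact rests on the same two
  displayed inputs as `selberg_fujii_small_gaps_of_moments'`.
* `Literature.NumberTheory.LFunctions.selberg_fujii_large_gaps_of_abs_moment'` — the large-gap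
  fact from the one-scale `L¹` lower bound `hS` of `SelbergFujiiSmallGaps.lean` and the
  mean-square upper bound: two one-sided moment bounds for `S(t + h) − S(t)`.

After this file the trust base of `selberg_fujii_large_gaps` is Fujii's (9.25.2) (two-sided)
and (9.25.3) with `k = 2` — or, more economically, the `L¹` lower bound `hS` and the mean-square
upper bound `h2` — unconditional theorems of Selberg (1946) / Fujii (1975) resting on Selberg's
approximate formula for `S(t)` and his density theorem near `σ = 1/2` (Titchmarsh Thm. 9.19 (C));
they are NOT proved in the tree and NOT vendored as named facts (D-0026: this file discharges
nothing and mints nothing).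

## The proof (Chebyshev on dyadic gap classes, explicit constants)

Titchmarsh–Heath-Brown, §9.25: from (9.25.2)–(9.25.3) "one may readily deduce" the tail bound
`#{n : 0 < γ_n ≤ T, γ_{n+1} − γ_n ≥ λ/log T} ≪ N(T) exp{−A λ^{1/2} (log λ)^{−1/4}}` uniformly for
`λ ≥ 2`, "whence, in particular," (9.25.4) `Σ_{0 < γ_n ≤ T} (γ_{n+1} − γ_n)^k ≪ N(T)/(log T)^k`.
With the second moment alone the same Chebyshev argument gives the polynomial tail
`≪ N(T) λ^{−3} log λ`, which suffices for every `k < 3`, in particular for the `k = 2` needed in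
§9.26. Write `g = γ_{n+1} − γ_n`, `L = log T`.
* (`SelbergFujii.log_div_le_riemannSiegelThetaDeriv`, `…sq_le_sq_zetaArgS_sub_of_eq`) for
  `u ≥ √T` and `L ≥ 24`, `θ'(u) ≥ ½ log(u/2π) − 2/u ≥ L/8`; so where `N(t + h) = N(t)`
  (`t ≥ √T`), `|S(t+h) − S(t)| = (θ(t+h) − θ(t))/π ≥ hL/(8π)`.
* (`SelbergFujii.mul_sum_gap_sub_le_integral`, `…sum_gap_sub_le`) a gap `[γ_n, γ_{n+1}]` with
  `n < N(T)`, `γ_n ≥ √T`, `g ≥ 2h` contains `[γ_n, γ_{n+1} − h)`, of length `g − h ≥ g/2`, on which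
  `N(t + h) = N(t)`; the gaps are adjacent intervals of the partition
  `0 ≤ γ_0 ≤ … ≤ γ_{N(T)} ≤ T + C₀ ≤ 2T` (`intervalIntegral.sum_integral_adjacent_intervals`), so
  `(hL/8π)² Σ_{g ≥ 2h} (g − h) ≤ ∫_0^{2T} (S(t+h) − S(t))² dt ≤ A · 2T log(3 + h log 2T)`.
* (`SelbergFujii.sum_sq_class_le`) on the class `2h ≤ g < 4h`, `g² ≤ 8h(g − h)`, so
  `Σ_class g² ≤ 512π² · A 2T log(3 + h log 2T)/(h L²)`; at `h = 2^j/L` the logarithm is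
  `≤ log(3 + 2^{j+1}) ≤ (j + 3) log 2`, so the class contributes `≤ 1024π² A T (j+3)/(2^j L)`, and
  (`SelbergFujii.sum_range_add_three_div_two_pow_le`) `Σ_{j<J} (j+3)/2^j = 8 − (2J+8)/2^J ≤ 8`;
  the classes `j < J` (`2^J ≤ L < 2^{J+1}`) cover `2/L ≤ g < 1` (`SelbergFujii.sum_sq_mid_le`:
  `≤ 8192π² A T/L`).
* (`SelbergFujii.sum_sq_top_le`) gaps `g ≥ 1`: `h = 1/2`, `log(3 + ½ log 2T) ≤ 3L`, and
  `g ≤ G := T₄ + C₀` for every gap (`SelbergFujii.gap_le_of_zetaZeroCount_lt`, from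
  `N(t) < N(t + C₀)` for `t ≥ T₄`, Riemann–von Mangoldt), `g² ≤ 2G(g − ½)`: `≤ 3072π² G A T/L`.
* gaps `g < 2/L`: at most `N(T) · 4/L²`; ordinates `γ_n < √T` (`SelbergFujii.sum_sq_low_le`):
  `Σ g² ≤ G Σ_{n < N(√T)} g = G (γ_{N(√T)} − γ_0) ≤ G (√T + C₀) ≤ 4G T/L` (`L ≤ 2√T`).
* (`SelbergFujii.exists_mul_log_le_zetaZeroCount`) `N(T) ≥ T L/(4π)` for large `T`, so
  `T/L ≤ 4π N(T)/L²`.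
Altogether `Σ_{n < N(T)} g² ≤ (4 + 4π (4G + 8192π² A + 3072π² G A)) N(T)/L²` for
`T ≥ max(T₀, T₈, e^{24}, T₄², C₀²)`.

## Design choices

* As in the rest of the cluster, the analytic input is a hypothesis written out in the binder
  (`h2`: the mean-square upper bound), not a new `def … : Prop`;
  `SelbergFujii.meanSquare_le_of_asymptotic` derives it from (9.25.2) as printed (hypothesis
  `h252` of `SelbergFujiiMoments.lean`, `0 ≤ h ≤ T/2`, error `A T (log(3 + h log T))^{1/2}`),
  using `√x ≤ x` for `x ≥ 1`.
* Heights below `√T` are discarded (there `log γ_n` is not comparable with `log T`); above `√T`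
  one fixed scale `log T` serves all ordinates, which avoids dyadic blocks in `T`.

## References

* E. C. Titchmarsh, *The Theory of the Riemann Zeta-Function*, 2nd ed. revised by
  D. R. Heath-Brown (1986), §9.25 (9.25.2)–(9.25.5) and the deduction of (9.25.4) sketched
  between (9.25.3) and (9.25.4); §9.26; Thm. 9.4 (Riemann–von Mangoldt); §4.17 (`θ'`).
  [key `Titchmarsh1986`]
* A. Fujii, *On the distribution of the zeros of the Riemann zeta function in short intervals*,
  Bull. Amer. Math. Soc. 81 (1975), 139–142 (Titchmarsh's Fujii [1]: (9.25.2)–(9.25.3));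
  *On the difference between r consecutive ordinates of the zeros of the Riemann zeta function*,
  Proc. Japan Acad. 51 (1975), 741–743 (Titchmarsh's Fujii [2]: (9.25.4)–(9.25.6)).
* A. Selberg, *Contributions to the theory of the Riemann zeta-function*, Arch. Math. Naturvid.
  48 (1946), no. 5, 89–155.
-/

noncomputable section

open Real MeasureTheory Set Filter Asymptotics

namespace Literature.NumberTheory.LFunctions

namespace SelbergFujii

/-! ### `θ` increases at rate `≫ log T` above height `√T` -/

/-- For `T ≥ 1` with `log T ≥ 24` and `u ≥ √T`: `θ'(u) ≥ (log T)/8`, from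
`|θ'(u) − ½ log(u/2π)| ≤ 2/u` (`abs_riemannSiegelThetaDeriv_sub_log_le`), `log u ≥ ½ log T` and
`log 2π < 2`. [cite: Titchmarsh1986, §4.17] -/
theorem log_div_le_riemannSiegelThetaDeriv {T u : ℝ} (hT : 1 ≤ T) (hL : 24 ≤ Real.log T)
    (hu : Real.sqrt T ≤ u) : Real.log T / 8 ≤ riemannSiegelThetaDeriv u := by
  have hπ : 3 < π := Real.pi_gt_three
  have h1 : (1 : ℝ) ≤ Real.sqrt T := by rw [← Real.sqrt_one]; exact Real.sqrt_le_sqrt hT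
  have hu1 : 1 ≤ u := h1.trans hu
  have hu0 : 0 < u := by linarith
  have hb := (abs_le.1 (abs_riemannSiegelThetaDeriv_sub_log_le hu1)).1
  have hlogu : Real.log T / 2 ≤ Real.log u := by
    rw [← Real.log_sqrt (by linarith)]
    exact Real.log_le_log (by linarith) hu
  have hsplit : Real.log (u / (2 * π)) = Real.log u - Real.log (2 * π) :=
    Real.log_div hu0.ne' (by positivity)
  have h2π := log_two_pi_lt_two
  have h2u : 2 / u ≤ 2 := by rw [div_le_iff₀ hu0]; linarith
  rw [hsplit] at hb
  linarith

/-- `θ(t + h) − θ(t) ≥ h B` whenever `θ' ≥ B` on `[t, t + h]` (`h ≥ 0`; `θ = ∫₀ θ'`).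
[folklore] -/
theorem mul_le_riemannSiegelTheta_sub {t h B : ℝ} (hh : 0 ≤ h)
    (hB : ∀ u ∈ Icc t (t + h), B ≤ riemannSiegelThetaDeriv u) :
    h * B ≤ riemannSiegelTheta (t + h) - riemannSiegelTheta t := by
  have hcont := continuous_riemannSiegelThetaDeriv_holds
  have hint : ∀ a b : ℝ, IntervalIntegrable riemannSiegelThetaDeriv volume a b := fun a b ↦
    hcont.intervalIntegrable a b
  have hsub : riemannSiegelTheta (t + h) - riemannSiegelTheta t =
      ∫ u in t..t + h, riemannSiegelThetaDeriv u := by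
    simp only [riemannSiegelTheta]
    rw [intervalIntegral.integral_interval_sub_left (hint 0 (t + h)) (hint 0 t)]
  rw [hsub]
  have hmono := intervalIntegral.integral_mono_on (by linarith) intervalIntegrable_const
    (hint t (t + h)) hB
  rwa [intervalIntegral.integral_const, smul_eq_mul, add_sub_cancel_left] at hmono

/-- On a gap above `√T`: if `N(t + h) = N(t)` with `t ≥ √T`, `h ≥ 0` (`T ≥ 1`, `log T ≥ 24`), then
`S(t + h) − S(t) = −(θ(t+h) − θ(t))/π` has absolute value at least `h log T/(8π)`; squared form.
[cite: Titchmarsh1986, §9.25] -/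
theorem sq_le_sq_zetaArgS_sub_of_eq {T t h : ℝ} (hT : 1 ≤ T) (hL : 24 ≤ Real.log T)
    (ht : Real.sqrt T ≤ t) (hh : 0 ≤ h) (hN : zetaZeroCount (t + h) = zetaZeroCount t) :
    (h * Real.log T / (8 * π)) ^ 2 ≤ (zetaArgS (t + h) - zetaArgS t) ^ 2 := by
  have hπ : 0 < π := Real.pi_pos
  have hθ : h * (Real.log T / 8) ≤ riemannSiegelTheta (t + h) - riemannSiegelTheta t :=
    mul_le_riemannSiegelTheta_sub hh fun u hu ↦
      log_div_le_riemannSiegelThetaDeriv hT hL (ht.trans hu.1)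
  have h0 : 0 ≤ h * (Real.log T / 8) := mul_nonneg hh (by linarith)
  have hsq := mul_self_le_mul_self h0 hθ
  rw [zetaArgS_sub, hN, sub_self, zero_sub, neg_sq, div_pow, div_pow,
    div_le_div_iff₀ (by positivity) (by positivity)]
  calc (h * Real.log T) ^ 2 * π ^ 2 = 64 * π ^ 2 * (h * (Real.log T / 8) * (h * (Real.log T / 8))) := by
        ring
    _ ≤ 64 * π ^ 2 * ((riemannSiegelTheta (t + h) - riemannSiegelTheta t) *
          (riemannSiegelTheta (t + h) - riemannSiegelTheta t)) :=
        mul_le_mul_of_nonneg_left hsq (by positivity)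
    _ = (riemannSiegelTheta (t + h) - riemannSiegelTheta t) ^ 2 * (8 * π) ^ 2 := by ring

/-! ### Chebyshev on a gap class -/

/-- **Chebyshev on the gaps of length `≥ 2h`.** For `T ≥ 1` with `log T ≥ 24`, `0 < h ≤ 1` and
`γ_{N(T)} ≤ 2T`: every gap `[γ_n, γ_{n+1}]` with `n < N(T)`, `γ_n ≥ √T` and
`γ_{n+1} − γ_n ≥ 2h` contains the interval `[γ_n, γ_{n+1} − h)` of length `≥ (γ_{n+1} − γ_n)/2`
on which `N(t + h) = N(t)`, hence `(S(t+h) − S(t))² ≥ (h log T/(8π))²`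
(`sq_le_sq_zetaArgS_sub_of_eq`); the gaps are disjoint, so
`(h log T/(8π))² Σ (γ_{n+1} − γ_n − h) ≤ ∫_0^{2T} (S(t+h) − S(t))² dt`.
[cite: Titchmarsh1986, §9.25, between (9.25.3) and (9.25.4)] -/
theorem mul_sum_gap_sub_le_integral {T h : ℝ} (hT : 1 ≤ T) (hL : 24 ≤ Real.log T)
    (hh : 0 < h) (hh1 : h ≤ 1) (hγ : zetaOrdinate (zetaZeroCount T) ≤ 2 * T) :
    (h * Real.log T / (8 * π)) ^ 2 *
        ∑ n ∈ (Finset.range (zetaZeroCount T)).filter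
            (fun n ↦ Real.sqrt T ≤ zetaOrdinate n ∧
              2 * h ≤ zetaOrdinate (n + 1) - zetaOrdinate n),
          (zetaOrdinate (n + 1) - zetaOrdinate n - h) ≤
      ∫ t in (0 : ℝ)..2 * T, (zetaArgS (t + h) - zetaArgS t) ^ 2 := by
  set F : ℝ → ℝ := fun t ↦ (zetaArgS (t + h) - zetaArgS t) ^ 2 with hF
  set c : ℝ := (h * Real.log T / (8 * π)) ^ 2 with hc
  have hrvm := riemann_von_mangoldt_holds
  have hmono := zetaOrdinate_mono_holds
  have hF0 : ∀ t, 0 ≤ F t := fun t ↦ sq_nonneg _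
  have hFi : IntervalIntegrable F volume 0 (2 * T) :=
    intervalIntegrable_zetaArgS_sub_pow (by linarith) hh.le hh1 2
  have hFi' : ∀ a b : ℝ, 0 ≤ a → a ≤ b → b ≤ 2 * T → IntervalIntegrable F volume a b := by
    intro a b ha hab hb
    refine hFi.mono_set ?_
    rw [uIcc_of_le hab, uIcc_of_le (by linarith)]
    exact Icc_subset_Icc ha hb
  have hγ0 : ∀ n, 0 ≤ zetaOrdinate n := zetaOrdinate_nonneg
  have hγN : ∀ n, n ≤ zetaZeroCount T → zetaOrdinate n ≤ 2 * T := fun n hn ↦ (hmono hn).trans hγ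
  have hFin : ∀ n, n < zetaZeroCount T →
      IntervalIntegrable F volume (zetaOrdinate n) (zetaOrdinate (n + 1)) := fun n hn ↦
    hFi' _ _ (hγ0 n) (hmono n.le_succ) (hγN (n + 1) hn)
  -- Step 1: the integrals over all the gaps add up to at most the full integral
  have hsum : ∑ n ∈ Finset.range (zetaZeroCount T),
      ∫ t in zetaOrdinate n..zetaOrdinate (n + 1), F t ≤ ∫ t in (0 : ℝ)..2 * T, F t := by
    rw [intervalIntegral.sum_integral_adjacent_intervals hFin]
    exact intervalIntegral.integral_mono_interval (hγ0 0) (hmono (Nat.zero_le _)) hγ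
      (Eventually.of_forall hF0) hFi
  -- Step 2: on a gap of length `≥ 2h` above `√T`
  have hgap : ∀ n ∈ (Finset.range (zetaZeroCount T)).filter
      (fun n ↦ Real.sqrt T ≤ zetaOrdinate n ∧ 2 * h ≤ zetaOrdinate (n + 1) - zetaOrdinate n),
      c * (zetaOrdinate (n + 1) - zetaOrdinate n - h) ≤
        ∫ t in zetaOrdinate n..zetaOrdinate (n + 1), F t := by
    intro n hn
    simp only [Finset.mem_filter, Finset.mem_range] at hn
    obtain ⟨hnN, hsq, h2h⟩ := hn
    have hab : zetaOrdinate n ≤ zetaOrdinate (n + 1) - h := by linarith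
    have e : c * (zetaOrdinate (n + 1) - zetaOrdinate n - h) =
        ∫ _ in zetaOrdinate n..zetaOrdinate (n + 1) - h, c := by
      rw [intervalIntegral.integral_const, smul_eq_mul]; ring
    rw [e]
    have hFab : IntervalIntegrable F volume (zetaOrdinate n) (zetaOrdinate (n + 1) - h) :=
      hFi' _ _ (hγ0 n) hab (by linarith [hγN (n + 1) hnN])
    calc ∫ _ in zetaOrdinate n..zetaOrdinate (n + 1) - h, c
        ≤ ∫ t in zetaOrdinate n..zetaOrdinate (n + 1) - h, F t := by
          refine intervalIntegral.integral_mono_on_of_le_Ioo hab intervalIntegrable_const hFab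
            fun t ht ↦ ?_
          have h1 : n + 1 ≤ zetaZeroCount t := hrvm.zetaOrdinate_le_iff.1 ht.1.le
          have h2 : zetaZeroCount (t + h) ≤ n + 1 :=
            hrvm.zetaZeroCount_le_of_lt_zetaOrdinate (by linarith [ht.2])
          have h3 : zetaZeroCount t ≤ zetaZeroCount (t + h) := zetaZeroCount_mono (by linarith)
          exact sq_le_sq_zetaArgS_sub_of_eq hT hL (hsq.trans ht.1.le) hh.le (by omega)
      _ ≤ ∫ t in zetaOrdinate n..zetaOrdinate (n + 1), F t :=
          intervalIntegral.integral_mono_interval le_rfl hab (by linarith)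
            (Eventually.of_forall hF0) (hFin n hnN)
  -- Step 3: sum over the class
  calc c * ∑ n ∈ (Finset.range (zetaZeroCount T)).filter
            (fun n ↦ Real.sqrt T ≤ zetaOrdinate n ∧
              2 * h ≤ zetaOrdinate (n + 1) - zetaOrdinate n),
          (zetaOrdinate (n + 1) - zetaOrdinate n - h)
      = ∑ n ∈ (Finset.range (zetaZeroCount T)).filter
            (fun n ↦ Real.sqrt T ≤ zetaOrdinate n ∧
              2 * h ≤ zetaOrdinate (n + 1) - zetaOrdinate n),
          c * (zetaOrdinate (n + 1) - zetaOrdinate n - h) := Finset.mul_sum _ _ _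
    _ ≤ ∑ n ∈ (Finset.range (zetaZeroCount T)).filter
            (fun n ↦ Real.sqrt T ≤ zetaOrdinate n ∧
              2 * h ≤ zetaOrdinate (n + 1) - zetaOrdinate n),
          ∫ t in zetaOrdinate n..zetaOrdinate (n + 1), F t := Finset.sum_le_sum hgap
    _ ≤ ∑ n ∈ Finset.range (zetaZeroCount T),
          ∫ t in zetaOrdinate n..zetaOrdinate (n + 1), F t :=
        Finset.sum_le_sum_of_subset_of_nonneg (Finset.filter_subset _ _) fun n hn _ ↦
          intervalIntegral.integral_nonneg (hmono n.le_succ) fun t _ ↦ hF0 t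
    _ ≤ ∫ t in (0 : ℝ)..2 * T, F t := hsum

/-- Division form of `mul_sum_gap_sub_le_integral`: if moreover
`∫_0^{2T} (S(t+h) − S(t))² dt ≤ B`, then `Σ (γ_{n+1} − γ_n − h) ≤ 64π² B/(h log T)²` over the
same gaps. [cite: Titchmarsh1986, §9.25, between (9.25.3) and (9.25.4)] -/
theorem sum_gap_sub_le {T h B : ℝ} (hT : 1 ≤ T) (hL : 24 ≤ Real.log T) (hh : 0 < h)
    (hh1 : h ≤ 1) (hγ : zetaOrdinate (zetaZeroCount T) ≤ 2 * T)
    (hB : ∫ t in (0 : ℝ)..2 * T, (zetaArgS (t + h) - zetaArgS t) ^ 2 ≤ B) :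
    ∑ n ∈ (Finset.range (zetaZeroCount T)).filter
        (fun n ↦ Real.sqrt T ≤ zetaOrdinate n ∧ 2 * h ≤ zetaOrdinate (n + 1) - zetaOrdinate n),
      (zetaOrdinate (n + 1) - zetaOrdinate n - h) ≤ 64 * π ^ 2 * B / (h * Real.log T) ^ 2 := by
  have hπ : 0 < π := Real.pi_pos
  have hLpos : 0 < Real.log T := by linarith
  have hmain := (mul_sum_gap_sub_le_integral hT hL hh hh1 hγ).trans hB
  rw [le_div_iff₀ (by positivity)]
  have e : (h * Real.log T / (8 * π)) ^ 2 * (64 * π ^ 2) = (h * Real.log T) ^ 2 := by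
    field_simp; ring
  calc _ = (h * Real.log T / (8 * π)) ^ 2 * (∑ n ∈ (Finset.range (zetaZeroCount T)).filter
        (fun n ↦ Real.sqrt T ≤ zetaOrdinate n ∧ 2 * h ≤ zetaOrdinate (n + 1) - zetaOrdinate n),
      (zetaOrdinate (n + 1) - zetaOrdinate n - h)) * (64 * π ^ 2) := by rw [← e]; ring
    _ ≤ B * (64 * π ^ 2) := mul_le_mul_of_nonneg_right hmain (by positivity)
    _ = 64 * π ^ 2 * B := by ring

/-- The dyadic gap class `2h ≤ γ_{n+1} − γ_n < 4h` (above `√T`): since `g² ≤ 8h(g − h)` for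
`2h ≤ g ≤ 4h`, `Σ_class (γ_{n+1} − γ_n)² ≤ 512π² B/(h log² T)` whenever
`∫_0^{2T} (S(t+h) − S(t))² dt ≤ B`. [cite: Titchmarsh1986, §9.25, between (9.25.3) and (9.25.4)] -/
theorem sum_sq_class_le {T h B : ℝ} (hT : 1 ≤ T) (hL : 24 ≤ Real.log T) (hh : 0 < h)
    (hh1 : h ≤ 1) (hγ : zetaOrdinate (zetaZeroCount T) ≤ 2 * T)
    (hB : ∫ t in (0 : ℝ)..2 * T, (zetaArgS (t + h) - zetaArgS t) ^ 2 ≤ B) :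
    ∑ n ∈ (Finset.range (zetaZeroCount T)).filter
        (fun n ↦ Real.sqrt T ≤ zetaOrdinate n ∧ 2 * h ≤ zetaOrdinate (n + 1) - zetaOrdinate n ∧
          zetaOrdinate (n + 1) - zetaOrdinate n < 4 * h),
      (zetaOrdinate (n + 1) - zetaOrdinate n) ^ 2 ≤ 512 * π ^ 2 * B / (h * (Real.log T) ^ 2) := by
  have hπ : 0 < π := Real.pi_pos
  have hLpos : 0 < Real.log T := by linarith
  have hS := sum_gap_sub_le hT hL hh hh1 hγ hB
  set C := (Finset.range (zetaZeroCount T)).filter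
        (fun n ↦ Real.sqrt T ≤ zetaOrdinate n ∧ 2 * h ≤ zetaOrdinate (n + 1) - zetaOrdinate n ∧
          zetaOrdinate (n + 1) - zetaOrdinate n < 4 * h) with hCdef
  set C' := (Finset.range (zetaZeroCount T)).filter
        (fun n ↦ Real.sqrt T ≤ zetaOrdinate n ∧ 2 * h ≤ zetaOrdinate (n + 1) - zetaOrdinate n)
    with hC'def
  have hsub : C ⊆ C' := Finset.monotone_filter_right _ fun n _ hn ↦ ⟨hn.1, hn.2.1⟩
  calc ∑ n ∈ C, (zetaOrdinate (n + 1) - zetaOrdinate n) ^ 2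
      ≤ ∑ n ∈ C, 8 * h * (zetaOrdinate (n + 1) - zetaOrdinate n - h) := by
        refine Finset.sum_le_sum fun n hn ↦ ?_
        rw [hCdef, Finset.mem_filter] at hn
        obtain ⟨-, -, h2, h4⟩ := hn
        nlinarith
    _ = 8 * h * ∑ n ∈ C, (zetaOrdinate (n + 1) - zetaOrdinate n - h) := (Finset.mul_sum _ _ _).symm
    _ ≤ 8 * h * ∑ n ∈ C', (zetaOrdinate (n + 1) - zetaOrdinate n - h) := by
        refine mul_le_mul_of_nonneg_left (Finset.sum_le_sum_of_subset_of_nonneg hsub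
          fun n hn _ ↦ ?_) (by positivity)
        rw [hC'def, Finset.mem_filter] at hn
        linarith [hn.2.2]
    _ ≤ 8 * h * (64 * π ^ 2 * B / (h * Real.log T) ^ 2) :=
        mul_le_mul_of_nonneg_left hS (by positivity)
    _ = 512 * π ^ 2 * B / (h * Real.log T ^ 2) := by field_simp; ring

/-- Sums of a non-negative function over a `Finset.biUnion` are at most the iterated sums.
[folklore] -/
theorem sum_biUnion_le_sum {ι κ : Type*} [DecidableEq κ] (s : Finset ι) (t : ι → Finset κ)
    {f : κ → ℝ} (hf : ∀ x, 0 ≤ f x) :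
    ∑ x ∈ s.biUnion t, f x ≤ ∑ i ∈ s, ∑ x ∈ t i, f x := by
  classical
  induction s using Finset.induction_on with
  | empty => simp
  | insert a s ha ih =>
    rw [Finset.biUnion_insert, Finset.sum_insert ha]
    have hu := Finset.sum_union_inter (s₁ := t a) (s₂ := s.biUnion t) (f := f)
    have hi : 0 ≤ ∑ x ∈ t a ∩ s.biUnion t, f x := Finset.sum_nonneg fun x _ ↦ hf x
    linarith

/-- The dyadic series of the argument: `Σ_{j < J} (j + 3)/2^j = 8 − (2J + 8)/2^J ≤ 8`.
[folklore] -/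
theorem sum_range_add_three_div_two_pow_le (J : ℕ) :
    ∑ j ∈ Finset.range J, ((j : ℝ) + 3) / 2 ^ j ≤ 8 := by
  have h : ∀ J : ℕ, ∑ j ∈ Finset.range J, ((j : ℝ) + 3) / 2 ^ j = 8 - (2 * J + 8) / 2 ^ J := by
    intro J
    induction J with
    | zero => norm_num
    | succ J ih =>
      rw [Finset.sum_range_succ, ih, pow_succ]
      push_cast
      field_simp
      ring
  rw [h]
  have : 0 ≤ (2 * (J : ℝ) + 8) / 2 ^ J := by positivity
  linarith

/-! ### More consequences of the Riemann–von Mangoldt formula -/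

/-- Every gap is bounded: if `N(t) < N(t + C₀)` for all `t ≥ T₄ ≥ 0`, then
`γ_{n+1} − γ_n ≤ T₄ + C₀` for every `n`. [cite: Titchmarsh1986, Thm. 9.4] -/
theorem gap_le_of_zetaZeroCount_lt {C₀ T₄ : ℝ} (hT₄ : 0 ≤ T₄)
    (hC₀ : ∀ t : ℝ, T₄ ≤ t → zetaZeroCount t < zetaZeroCount (t + C₀)) (n : ℕ) :
    zetaOrdinate (n + 1) - zetaOrdinate n ≤ T₄ + C₀ := by
  have hrvm := riemann_von_mangoldt_holds
  have h0 := zetaOrdinate_nonneg n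
  have h1 : n + 1 ≤ zetaZeroCount (max (zetaOrdinate n) T₄) :=
    hrvm.zetaOrdinate_le_iff.1 (le_max_left _ _)
  have h2 := hC₀ _ (le_max_right (zetaOrdinate n) T₄)
  have h3 : zetaOrdinate (n + 1) ≤ max (zetaOrdinate n) T₄ + C₀ :=
    hrvm.zetaOrdinate_le_iff.2 (by omega)
  have h4 : max (zetaOrdinate n) T₄ ≤ zetaOrdinate n + T₄ := max_le (by linarith) (by linarith)
  linarith

/-- `γ_{N(t)} ≤ t + C₀` as soon as `N(t) < N(t + C₀)`. [cite: Titchmarsh1986, Thm. 9.4] -/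
theorem zetaOrdinate_zetaZeroCount_le {t C₀ : ℝ} (h : zetaZeroCount t < zetaZeroCount (t + C₀)) :
    zetaOrdinate (zetaZeroCount t) ≤ t + C₀ :=
  riemann_von_mangoldt_holds.zetaOrdinate_le_iff.2 (by omega)

/-- `N(T) ≥ T log T/(4π)` for all large `T` (Riemann–von Mangoldt). [cite: Titchmarsh1986, Thm. 9.4] -/
theorem exists_mul_log_le_zetaZeroCount :
    ∃ T₀ : ℝ, ∀ T : ℝ, T₀ ≤ T → T * Real.log T / (4 * π) ≤ zetaZeroCount T := by
  obtain ⟨K₀, hK₀, T₀, hT₀, h⟩ := exists_abs_zetaZeroCount_sub_le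
  have hπ : 3 < π := Real.pi_gt_three
  refine ⟨max T₀ (max (Real.exp 12) (8 * π * K₀)), fun T hT ↦ ?_⟩
  simp only [max_le_iff] at hT
  obtain ⟨hT0, hTe, hTK⟩ := hT
  have hT1 : 1 ≤ T := hT₀.trans hT0
  have hL : 12 ≤ Real.log T := by
    rw [← Real.log_exp 12]; exact Real.log_le_log (Real.exp_pos _) hTe
  have h1 := (abs_le.1 (h T hT0)).1
  have hsplit : Real.log (T / (2 * π)) = Real.log T - Real.log (2 * π) :=
    Real.log_div (by positivity) (by positivity)
  have h2π := log_two_pi_lt_two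
  rw [hsplit] at h1
  rw [div_le_iff₀ (by positivity)]
  -- `N ≥ (T/2π)(L − 3) − K₀ L` and `(T/2π)(L − 3) − K₀ L ≥ T L/(4π)`
  have hA : T / (2 * π) * (Real.log T - 3) - K₀ * Real.log T ≤ zetaZeroCount T := by
    have : T / (2 * π) * (Real.log T - 3) ≤
        T / (2 * π) * (Real.log T - Real.log (2 * π)) - T / (2 * π) := by
      have : T / (2 * π) * (Real.log T - 3) =
          T / (2 * π) * (Real.log T - 2) - T / (2 * π) := by ring
      rw [this]
      gcongr
    linarith
  have hB : K₀ * Real.log T * (4 * π) ≤ T / 2 * Real.log T := by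
    have := mul_le_mul_of_nonneg_right hTK (by linarith : (0 : ℝ) ≤ Real.log T)
    nlinarith
  have hC : T / (2 * π) * (Real.log T - 3) * (4 * π) = 2 * T * Real.log T - 6 * T := by
    field_simp
    ring
  have hD : 6 * T ≤ T / 2 * Real.log T := by nlinarith
  nlinarith [mul_le_mul_of_nonneg_right hA (by positivity : (0 : ℝ) ≤ 4 * π)]

/-! ### The four ranges of the gap second moment -/

/-- Low ordinates: `Σ_{n < N(T), γ_n < √T} (γ_{n+1} − γ_n)² ≤ G (γ_{N(√T)} − γ_0) ≤ G (√T + C₀)`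
when every gap is `≤ G` and `γ_{N(√T)} ≤ √T + C₀`. [folklore] -/
theorem sum_sq_low_le {T C₀ G : ℝ} (hG : 0 ≤ G)
    (hgapG : ∀ n, zetaOrdinate (n + 1) - zetaOrdinate n ≤ G)
    (hγs : zetaOrdinate (zetaZeroCount (Real.sqrt T)) ≤ Real.sqrt T + C₀) :
    ∑ n ∈ (Finset.range (zetaZeroCount T)).filter (fun n ↦ ¬ Real.sqrt T ≤ zetaOrdinate n),
      (zetaOrdinate (n + 1) - zetaOrdinate n) ^ 2 ≤ G * (Real.sqrt T + C₀) := by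
  have hrvm := riemann_von_mangoldt_holds
  have hmono := zetaOrdinate_mono_holds
  have hg0 : ∀ n, 0 ≤ zetaOrdinate (n + 1) - zetaOrdinate n := fun n ↦
    sub_nonneg.2 (hmono n.le_succ)
  have hsub : (Finset.range (zetaZeroCount T)).filter (fun n ↦ ¬ Real.sqrt T ≤ zetaOrdinate n) ⊆
      Finset.range (zetaZeroCount (Real.sqrt T)) := by
    intro n hn
    rw [Finset.mem_filter, not_le] at hn
    rw [Finset.mem_range]
    have := hrvm.zetaOrdinate_le_iff.1 hn.2.le
    omega
  calc ∑ n ∈ (Finset.range (zetaZeroCount T)).filter (fun n ↦ ¬ Real.sqrt T ≤ zetaOrdinate n),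
        (zetaOrdinate (n + 1) - zetaOrdinate n) ^ 2
      ≤ ∑ n ∈ (Finset.range (zetaZeroCount T)).filter (fun n ↦ ¬ Real.sqrt T ≤ zetaOrdinate n),
          G * (zetaOrdinate (n + 1) - zetaOrdinate n) :=
        Finset.sum_le_sum fun n _ ↦ by
          rw [sq]; exact mul_le_mul_of_nonneg_right (hgapG n) (hg0 n)
    _ ≤ ∑ n ∈ Finset.range (zetaZeroCount (Real.sqrt T)),
          G * (zetaOrdinate (n + 1) - zetaOrdinate n) :=
        Finset.sum_le_sum_of_subset_of_nonneg hsub fun n _ _ ↦ mul_nonneg hG (hg0 n)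
    _ = G * (zetaOrdinate (zetaZeroCount (Real.sqrt T)) - zetaOrdinate 0) := by
        rw [← Finset.mul_sum, Finset.sum_range_sub]
    _ ≤ G * (Real.sqrt T + C₀) := by
        refine mul_le_mul_of_nonneg_left ?_ hG
        linarith [zetaOrdinate_nonneg 0]

/-- Middle gaps `2/log T ≤ γ_{n+1} − γ_n < 1` above `√T`: covered by the dyadic classes
`[2^{j+1}/log T, 2^{j+2}/log T)`, `j < J` (`2^J ≤ log T < 2^{J+1}`), each bounded by
`sum_sq_class_le` at `h = 2^j/log T` with `log(3 + h log 2T) ≤ j + 3`; the series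
`Σ (j+3)/2^j ≤ 8` gives `Σ (γ_{n+1} − γ_n)² ≤ 8192 π² A T/log T` from the mean-square bound
`∫_0^{2T} (S(t+h) − S(t))² dt ≤ A · 2T log(3 + h log 2T)` (`0 ≤ h ≤ 1`).
[cite: Titchmarsh1986, §9.25, between (9.25.3) and (9.25.4)] -/
theorem sum_sq_mid_le {T A : ℝ} (hT : 1 ≤ T) (hL : 24 ≤ Real.log T) (hA : 0 ≤ A)
    (hγ : zetaOrdinate (zetaZeroCount T) ≤ 2 * T)
    (hA2 : ∀ h : ℝ, 0 ≤ h → h ≤ 1 →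
      ∫ t in (0 : ℝ)..2 * T, (zetaArgS (t + h) - zetaArgS t) ^ 2 ≤
        A * (2 * T * Real.log (3 + h * Real.log (2 * T)))) :
    ∑ n ∈ (Finset.range (zetaZeroCount T)).filter
        (fun n ↦ Real.sqrt T ≤ zetaOrdinate n ∧
          2 / Real.log T ≤ zetaOrdinate (n + 1) - zetaOrdinate n ∧
            zetaOrdinate (n + 1) - zetaOrdinate n < 1),
      (zetaOrdinate (n + 1) - zetaOrdinate n) ^ 2 ≤ 8192 * π ^ 2 * A * T / Real.log T := by
  have hπ : 0 < π := Real.pi_pos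
  set L := Real.log T with hLdef
  have hL1 : 1 ≤ L := by linarith
  have hLpos : 0 < L := by linarith
  have hT0 : 0 < T := by linarith
  have hlogT2T : L ≤ Real.log (2 * T) := Real.log_le_log hT0 (by linarith)
  have hlog2T : Real.log (2 * T) ≤ 2 * L := by
    rw [Real.log_mul two_ne_zero hT0.ne']
    have := Real.log_two_lt_d9; linarith
  obtain ⟨J, hJ1, hJ2⟩ := exists_nat_pow_near hL1 one_lt_two
  -- the dyadic classes
  set cls : ℕ → Finset ℕ := fun j ↦ (Finset.range (zetaZeroCount T)).filter
      (fun n ↦ Real.sqrt T ≤ zetaOrdinate n ∧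
        2 * (2 ^ j / L) ≤ zetaOrdinate (n + 1) - zetaOrdinate n ∧
          zetaOrdinate (n + 1) - zetaOrdinate n < 4 * (2 ^ j / L)) with hcls
  -- per-class bound
  have hclass : ∀ j ∈ Finset.range J, ∑ n ∈ cls j, (zetaOrdinate (n + 1) - zetaOrdinate n) ^ 2 ≤
      1024 * π ^ 2 * A * T / L * (((j : ℝ) + 3) / 2 ^ j) := by
    intro j hj
    rw [Finset.mem_range] at hj
    have h2j : (0 : ℝ) < 2 ^ j := by positivity
    have h1j : (1 : ℝ) ≤ 2 ^ j := one_le_pow₀ (by norm_num)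
    have hjJ : (2 : ℝ) ^ (j + 1) ≤ 2 ^ J := pow_le_pow_right₀ (by norm_num) hj
    have hh : (0 : ℝ) < 2 ^ j / L := by positivity
    have hh1 : (2 : ℝ) ^ j / L ≤ 1 := by
      rw [div_le_one hLpos]
      have : (2 : ℝ) ^ (j + 1) = 2 * 2 ^ j := by ring
      linarith
    have hB := hA2 (2 ^ j / L) hh.le hh1
    refine (sum_sq_class_le hT hL hh hh1 hγ hB).trans ?_
    -- the logarithm is at most `j + 3`
    have hx : 2 ^ j / L * Real.log (2 * T) ≤ 2 * 2 ^ j := by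
      rw [div_mul_eq_mul_div, div_le_iff₀ hLpos]
      nlinarith
    have h0x : 0 ≤ 2 ^ j / L * Real.log (2 * T) := mul_nonneg hh.le (by linarith)
    have h8 : 3 + 2 ^ j / L * Real.log (2 * T) ≤ 2 ^ (j + 3) := by
      have : (2 : ℝ) ^ (j + 3) = 8 * 2 ^ j := by ring
      linarith
    have hlogj : Real.log (3 + 2 ^ j / L * Real.log (2 * T)) ≤ j + 3 := by
      have hl2 := Real.log_two_lt_d9
      have hl2' := Real.log_two_gt_d9
      calc Real.log (3 + 2 ^ j / L * Real.log (2 * T))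
          ≤ Real.log (2 ^ (j + 3)) := Real.log_le_log (by linarith) h8
        _ = (j + 3) * Real.log 2 := by rw [Real.log_pow]; push_cast; ring
        _ ≤ (j + 3) * 1 := mul_le_mul_of_nonneg_left (by linarith) (by positivity)
        _ = j + 3 := mul_one _
    calc 512 * π ^ 2 * (A * (2 * T * Real.log (3 + 2 ^ j / L * Real.log (2 * T)))) /
          (2 ^ j / L * L ^ 2)
        ≤ 512 * π ^ 2 * (A * (2 * T * (j + 3))) / (2 ^ j / L * L ^ 2) := by gcongr
      _ = 1024 * π ^ 2 * A * T / L * (((j : ℝ) + 3) / 2 ^ j) := by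
          field_simp
          ring
  -- the classes cover the middle range
  have hcover : (Finset.range (zetaZeroCount T)).filter
        (fun n ↦ Real.sqrt T ≤ zetaOrdinate n ∧
          2 / L ≤ zetaOrdinate (n + 1) - zetaOrdinate n ∧
            zetaOrdinate (n + 1) - zetaOrdinate n < 1) ⊆ (Finset.range J).biUnion cls := by
    intro n hn
    rw [Finset.mem_filter] at hn
    obtain ⟨hnR, hs, h2L, h1⟩ := hn
    rw [Finset.mem_biUnion]
    have hgL : 2 ≤ (zetaOrdinate (n + 1) - zetaOrdinate n) * L := (div_le_iff₀ hLpos).1 h2L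
    have hx1 : 1 ≤ (zetaOrdinate (n + 1) - zetaOrdinate n) * L / 2 := by
      rw [le_div_iff₀ two_pos]; linarith
    obtain ⟨m, hm1, hm2⟩ := exists_nat_pow_near hx1 one_lt_two
    have hgL' : (zetaOrdinate (n + 1) - zetaOrdinate n) * L < L := by
      have := mul_lt_mul_of_pos_right h1 hLpos
      rwa [one_mul] at this
    have hmJ : m < J := by
      by_contra hmJ
      rw [not_lt] at hmJ
      have h1' : (2 : ℝ) ^ J ≤ 2 ^ m := pow_le_pow_right₀ (by norm_num) hmJ
      have h3' : (2 : ℝ) ^ (J + 1) = 2 * 2 ^ J := by ring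
      have h4' : (2 : ℝ) ^ m ≤ (zetaOrdinate (n + 1) - zetaOrdinate n) * L / 2 := hm1
      rw [le_div_iff₀ two_pos] at h4'
      linarith
    refine ⟨m, Finset.mem_range.2 hmJ, ?_⟩
    simp only [hcls, Finset.mem_filter]
    refine ⟨hnR, hs, ?_, ?_⟩
    · rw [mul_div_assoc', div_le_iff₀ hLpos]
      have := (le_div_iff₀ two_pos).1 hm1
      linarith
    · rw [mul_div_assoc', lt_div_iff₀ hLpos]
      have := (div_lt_iff₀ two_pos).1 hm2
      have e : (2 : ℝ) ^ (m + 1) * 2 = 4 * 2 ^ m := by ring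
      linarith
  -- assemble
  have hnonneg : ∀ n, 0 ≤ (zetaOrdinate (n + 1) - zetaOrdinate n) ^ 2 := fun n ↦ sq_nonneg _
  calc ∑ n ∈ (Finset.range (zetaZeroCount T)).filter
        (fun n ↦ Real.sqrt T ≤ zetaOrdinate n ∧
          2 / L ≤ zetaOrdinate (n + 1) - zetaOrdinate n ∧
            zetaOrdinate (n + 1) - zetaOrdinate n < 1),
        (zetaOrdinate (n + 1) - zetaOrdinate n) ^ 2
      ≤ ∑ n ∈ (Finset.range J).biUnion cls, (zetaOrdinate (n + 1) - zetaOrdinate n) ^ 2 :=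
        Finset.sum_le_sum_of_subset_of_nonneg hcover fun n _ _ ↦ hnonneg n
    _ ≤ ∑ j ∈ Finset.range J, ∑ n ∈ cls j, (zetaOrdinate (n + 1) - zetaOrdinate n) ^ 2 :=
        sum_biUnion_le_sum _ _ hnonneg
    _ ≤ ∑ j ∈ Finset.range J, 1024 * π ^ 2 * A * T / L * (((j : ℝ) + 3) / 2 ^ j) :=
        Finset.sum_le_sum hclass
    _ = 1024 * π ^ 2 * A * T / L * ∑ j ∈ Finset.range J, ((j : ℝ) + 3) / 2 ^ j := by
        rw [Finset.mul_sum]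
    _ ≤ 1024 * π ^ 2 * A * T / L * 8 :=
        mul_le_mul_of_nonneg_left (sum_range_add_three_div_two_pow_le J) (by positivity)
    _ = 8192 * π ^ 2 * A * T / L := by ring

/-- Top gaps `γ_{n+1} − γ_n ≥ 1` above `√T`: `sum_gap_sub_le` at `h = 1/2` with
`log(3 + ½ log 2T) ≤ 3 log T`, and `g² ≤ G g ≤ 2G (g − ½)` for `1 ≤ g ≤ G`.
[cite: Titchmarsh1986, §9.25, between (9.25.3) and (9.25.4)] -/
theorem sum_sq_top_le {T A G : ℝ} (hT : 1 ≤ T) (hL : 24 ≤ Real.log T) (hA : 0 ≤ A) (hG : 0 ≤ G)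
    (hγ : zetaOrdinate (zetaZeroCount T) ≤ 2 * T)
    (hgapG : ∀ n, zetaOrdinate (n + 1) - zetaOrdinate n ≤ G)
    (hA2 : ∀ h : ℝ, 0 ≤ h → h ≤ 1 →
      ∫ t in (0 : ℝ)..2 * T, (zetaArgS (t + h) - zetaArgS t) ^ 2 ≤
        A * (2 * T * Real.log (3 + h * Real.log (2 * T)))) :
    ∑ n ∈ (Finset.range (zetaZeroCount T)).filter
        (fun n ↦ Real.sqrt T ≤ zetaOrdinate n ∧
          2 * (1 / 2) ≤ zetaOrdinate (n + 1) - zetaOrdinate n),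
      (zetaOrdinate (n + 1) - zetaOrdinate n) ^ 2 ≤ 3072 * π ^ 2 * G * A * T / Real.log T := by
  have hπ : 0 < π := Real.pi_pos
  set L := Real.log T with hLdef
  have hLpos : 0 < L := by linarith
  have hT0 : 0 < T := by linarith
  have hB := hA2 (1 / 2) (by norm_num) (by norm_num)
  have hS := sum_gap_sub_le hT hL (by norm_num : (0 : ℝ) < 1 / 2) (by norm_num) hγ hB
  have hlogT2T : L ≤ Real.log (2 * T) := Real.log_le_log hT0 (by linarith)
  have hlog2T : Real.log (2 * T) ≤ 2 * L := by
    rw [Real.log_mul two_ne_zero hT0.ne']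
    have := Real.log_two_lt_d9; linarith
  have hpos : 0 < 3 + 1 / 2 * Real.log (2 * T) := by nlinarith
  have hlog : Real.log (3 + 1 / 2 * Real.log (2 * T)) ≤ 3 * L := by
    have := Real.log_le_sub_one_of_pos hpos
    linarith
  set Top := (Finset.range (zetaZeroCount T)).filter
      (fun n ↦ Real.sqrt T ≤ zetaOrdinate n ∧
        2 * (1 / 2) ≤ zetaOrdinate (n + 1) - zetaOrdinate n) with hTop
  calc ∑ n ∈ Top, (zetaOrdinate (n + 1) - zetaOrdinate n) ^ 2
      ≤ ∑ n ∈ Top, 2 * G * (zetaOrdinate (n + 1) - zetaOrdinate n - 1 / 2) := by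
        refine Finset.sum_le_sum fun n hn ↦ ?_
        rw [hTop, Finset.mem_filter] at hn
        have h1 : 1 ≤ zetaOrdinate (n + 1) - zetaOrdinate n := by linarith [hn.2.2]
        have h2 := hgapG n
        nlinarith [mul_nonneg (sub_nonneg.2 h2)
            (by linarith : (0 : ℝ) ≤ zetaOrdinate (n + 1) - zetaOrdinate n),
          mul_nonneg (sub_nonneg.2 h1) hG]
    _ = 2 * G * ∑ n ∈ Top, (zetaOrdinate (n + 1) - zetaOrdinate n - 1 / 2) :=
        (Finset.mul_sum _ _ _).symm
    _ ≤ 2 * G * (64 * π ^ 2 * (A * (2 * T * Real.log (3 + 1 / 2 * Real.log (2 * T)))) /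
          (1 / 2 * L) ^ 2) := mul_le_mul_of_nonneg_left hS (by positivity)
    _ ≤ 2 * G * (64 * π ^ 2 * (A * (2 * T * (3 * L))) / (1 / 2 * L) ^ 2) := by gcongr
    _ = 3072 * π ^ 2 * G * A * T / L := by
        field_simp
        ring

/-! ### (9.25.4) with `k = 2` -/

/-- **The gap second moment (9.25.4)₂ from the mean square of `S(t + h) − S(t)`.** If
`∫_0^T (S(t+h) − S(t))² dt ≤ A T log(3 + h log T)` for `T ≥ T₀` and `0 ≤ h ≤ 1` (the upper-bound
half of Fujii's (9.25.2), in the uniformity `0 ≤ h ≤ 1`), then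
`Σ_{0 < γ_n ≤ T} (γ_{n+1} − γ_n)² ≤ C N(T)/log² T` for all large `T` — the case `k = 2` of
(9.25.4), in exactly the form consumed by `selberg_fujii_large_gaps_of_first_moment`.
Titchmarsh–Heath-Brown deduce (9.25.4) from (9.25.2)–(9.25.3) through Fujii's exponential tail
bound `#{n : γ_{n+1} − γ_n ≥ λ/log T} ≪ N(T) exp(−A λ^{1/2} (log λ)^{−1/4})`; with the second
moment alone Chebyshev's inequality on the dyadic gap classes (`sum_gap_sub_le`: on a gap of
length `≥ 2h`, `|S(t+h) − S(t)| = (θ(t+h) − θ(t))/π ≥ h log T/(8π)` over a length `≥ g/2`) gives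
the polynomial tail `≪ N(T) λ^{−3} log λ`, which suffices for every `k < 3`. The ranges
`γ_n < √T` (total length `≤ √T + O(1)`, gaps `O(1)`), `g < 2/log T` (trivial),
`2/log T ≤ g < 1` (`sum_sq_mid_le`) and `g ≥ 1` (`sum_sq_top_le`) are treated separately, and
`N(T) ≥ T log T/(4π)` (Riemann–von Mangoldt) converts `T/log T` into `N(T)/log² T`.
[cite: Titchmarsh1986, §9.25 (9.25.2), (9.25.4)] -/
theorem gap_sq_sum_of_meanSquare
    (h2 : ∃ A : ℝ, ∃ T₀ : ℝ, ∀ T : ℝ, T₀ ≤ T → ∀ h : ℝ, 0 ≤ h → h ≤ 1 →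
      ∫ t in (0 : ℝ)..T, (zetaArgS (t + h) - zetaArgS t) ^ 2 ≤
        A * (T * Real.log (3 + h * Real.log T))) :
    ∃ C : ℝ, ∃ T₂ : ℝ, ∀ T : ℝ, T₂ ≤ T →
      ∑ n ∈ Finset.range (zetaZeroCount T), (zetaOrdinate (n + 1) - zetaOrdinate n) ^ 2 ≤
        C * (zetaZeroCount T : ℝ) / (Real.log T) ^ 2 := by
  obtain ⟨A₀, T₀, h2⟩ := h2
  -- WLOG `A ≥ 1`
  obtain ⟨A, hA1, hA⟩ : ∃ A : ℝ, 1 ≤ A ∧ ∀ T : ℝ, T₀ ≤ T → 1 ≤ T → ∀ h : ℝ, 0 ≤ h → h ≤ 1 →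
      ∫ t in (0 : ℝ)..T, (zetaArgS (t + h) - zetaArgS t) ^ 2 ≤
        A * (T * Real.log (3 + h * Real.log T)) := by
    refine ⟨max A₀ 1, le_max_right _ _, fun T hT hT1 h hh hh1 ↦ (h2 T hT h hh hh1).trans ?_⟩
    have : 0 ≤ T * Real.log (3 + h * Real.log T) :=
      mul_nonneg (by linarith) (Real.log_nonneg (by nlinarith [Real.log_nonneg hT1]))
    exact mul_le_mul_of_nonneg_right (le_max_left _ _) this
  obtain ⟨C₀, hC₀, T₄', hC₀4'⟩ := exists_zetaZeroCount_lt_add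
  -- WLOG `T₄ ≥ 1`
  obtain ⟨T₄, hT₄1, hC₀4⟩ : ∃ T₄ : ℝ, 1 ≤ T₄ ∧
      ∀ t : ℝ, T₄ ≤ t → zetaZeroCount t < zetaZeroCount (t + C₀) :=
    ⟨max T₄' 1, le_max_right _ _, fun t ht ↦ hC₀4' t ((le_max_left _ _).trans ht)⟩
  obtain ⟨T₈, hT₈⟩ := exists_mul_log_le_zetaZeroCount
  have hπ : 3 < π := Real.pi_gt_three
  have hmono := zetaOrdinate_mono_holds
  have hg0 : ∀ n, 0 ≤ zetaOrdinate (n + 1) - zetaOrdinate n := fun n ↦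
    sub_nonneg.2 (hmono n.le_succ)
  set G : ℝ := T₄ + C₀ with hGdef
  have hG0 : 0 ≤ G := by positivity
  have hgapG : ∀ n, zetaOrdinate (n + 1) - zetaOrdinate n ≤ G :=
    gap_le_of_zetaZeroCount_lt (by linarith) hC₀4
  refine ⟨4 + 4 * π * (4 * G + 8192 * π ^ 2 * A + 3072 * π ^ 2 * G * A),
    max (max T₀ T₈) (max (Real.exp 24) (max (T₄ ^ 2) (C₀ ^ 2))), fun T hT ↦ ?_⟩
  simp only [max_le_iff] at hT
  obtain ⟨⟨hT0, hT8⟩, hTe, hT4, hTC⟩ := hT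
  -- sizes
  have hT1 : 1 ≤ T := (Real.one_le_exp (by norm_num)).trans hTe
  have hT0' : 0 < T := by linarith
  set L := Real.log T with hLdef
  have hL : 24 ≤ L := by
    rw [hLdef, ← Real.log_exp 24]; exact Real.log_le_log (Real.exp_pos _) hTe
  have hLpos : 0 < L := by linarith
  set s := Real.sqrt T with hsdef
  have hs0 : 0 < s := Real.sqrt_pos.2 hT0'
  have hss : s * s = T := Real.mul_self_sqrt hT0'.le
  have hs4 : T₄ ≤ s := by rw [hsdef, Real.le_sqrt (by linarith) hT0'.le]; exact hT4
  have hsC : C₀ ≤ s := by rw [hsdef, Real.le_sqrt hC₀.le hT0'.le]; exact hTC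
  have hs1 : 1 ≤ s := hT₄1.trans hs4
  have hsT : s ≤ T := by nlinarith
  have hLs : L ≤ 2 * s := by
    have h1 : Real.log s = L / 2 := by rw [hsdef, Real.log_sqrt hT0'.le]
    have h2 := Real.log_le_sub_one_of_pos hs0
    linarith
  -- consequences of the bounded gaps
  have hγ : zetaOrdinate (zetaZeroCount T) ≤ 2 * T := by
    have := zetaOrdinate_zetaZeroCount_le (hC₀4 T (hs4.trans hsT))
    linarith [hsC.trans hsT]
  have hγs : zetaOrdinate (zetaZeroCount s) ≤ s + C₀ :=
    zetaOrdinate_zetaZeroCount_le (hC₀4 s hs4)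
  -- the mean square on `[0, 2T]`
  have hA2 : ∀ h : ℝ, 0 ≤ h → h ≤ 1 →
      ∫ t in (0 : ℝ)..2 * T, (zetaArgS (t + h) - zetaArgS t) ^ 2 ≤
        A * (2 * T * Real.log (3 + h * Real.log (2 * T))) :=
    fun h hh hh1 ↦ hA (2 * T) (by linarith) (by linarith) h hh hh1
  -- the four pieces
  have hlow := sum_sq_low_le (T := T) hG0 hgapG hγs
  have hmid := sum_sq_mid_le hT1 hL (by linarith) hγ hA2
  have htop := sum_sq_top_le hT1 hL (by linarith) hG0 hγ hgapG hA2
  have hnonneg : ∀ n, 0 ≤ (zetaOrdinate (n + 1) - zetaOrdinate n) ^ 2 := fun n ↦ sq_nonneg _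
  set R := Finset.range (zetaZeroCount T) with hRdef
  -- split the range of summation
  rw [← Finset.sum_filter_add_sum_filter_not R (fun n ↦ s ≤ zetaOrdinate n),
    ← Finset.sum_filter_add_sum_filter_not (R.filter fun n ↦ s ≤ zetaOrdinate n)
      (fun n ↦ zetaOrdinate (n + 1) - zetaOrdinate n < 2 / L),
    ← Finset.sum_filter_add_sum_filter_not
      ((R.filter fun n ↦ s ≤ zetaOrdinate n).filter
        fun n ↦ ¬ zetaOrdinate (n + 1) - zetaOrdinate n < 2 / L)
      (fun n ↦ zetaOrdinate (n + 1) - zetaOrdinate n < 1)]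
  -- small gaps: trivially
  have hsmall : ∑ n ∈ (R.filter fun n ↦ s ≤ zetaOrdinate n).filter
      (fun n ↦ zetaOrdinate (n + 1) - zetaOrdinate n < 2 / L),
        (zetaOrdinate (n + 1) - zetaOrdinate n) ^ 2 ≤ 4 * (zetaZeroCount T : ℝ) / L ^ 2 := by
    have hle : ∀ n ∈ (R.filter fun n ↦ s ≤ zetaOrdinate n).filter
        (fun n ↦ zetaOrdinate (n + 1) - zetaOrdinate n < 2 / L),
        (zetaOrdinate (n + 1) - zetaOrdinate n) ^ 2 ≤ 4 / L ^ 2 := by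
      intro n hn
      rw [Finset.mem_filter] at hn
      have := pow_le_pow_left₀ (hg0 n) hn.2.le 2
      calc _ ≤ (2 / L) ^ 2 := this
        _ = 4 / L ^ 2 := by rw [div_pow]; norm_num
    have hcard : (((R.filter fun n ↦ s ≤ zetaOrdinate n).filter
        (fun n ↦ zetaOrdinate (n + 1) - zetaOrdinate n < 2 / L)).card : ℝ) ≤ zetaZeroCount T := by
      have h1 := ((Finset.card_filter_le (R.filter fun n ↦ s ≤ zetaOrdinate n)
        (fun n ↦ zetaOrdinate (n + 1) - zetaOrdinate n < 2 / L)).trans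
          (Finset.card_filter_le R (fun n ↦ s ≤ zetaOrdinate n))).trans
            (Finset.card_range (zetaZeroCount T)).le
      exact_mod_cast h1
    calc _ ≤ ∑ n ∈ (R.filter fun n ↦ s ≤ zetaOrdinate n).filter
          (fun n ↦ zetaOrdinate (n + 1) - zetaOrdinate n < 2 / L), (4 / L ^ 2 : ℝ) :=
          Finset.sum_le_sum hle
      _ = ((R.filter fun n ↦ s ≤ zetaOrdinate n).filter
          (fun n ↦ zetaOrdinate (n + 1) - zetaOrdinate n < 2 / L)).card * (4 / L ^ 2) := by
          rw [Finset.sum_const, nsmul_eq_mul]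
      _ ≤ (zetaZeroCount T : ℝ) * (4 / L ^ 2) := mul_le_mul_of_nonneg_right hcard (by positivity)
      _ = 4 * (zetaZeroCount T : ℝ) / L ^ 2 := by ring
  -- middle gaps
  have hmid' : ∑ n ∈ ((R.filter fun n ↦ s ≤ zetaOrdinate n).filter
      (fun n ↦ ¬ zetaOrdinate (n + 1) - zetaOrdinate n < 2 / L)).filter
        (fun n ↦ zetaOrdinate (n + 1) - zetaOrdinate n < 1),
        (zetaOrdinate (n + 1) - zetaOrdinate n) ^ 2 ≤ 8192 * π ^ 2 * A * T / L := by
    refine le_trans (Finset.sum_le_sum_of_subset_of_nonneg ?_ fun n _ _ ↦ hnonneg n) hmid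
    intro n hn
    simp only [Finset.mem_filter, not_lt] at hn ⊢
    exact ⟨hn.1.1.1, hn.1.1.2, hn.1.2, hn.2⟩
  -- top gaps
  have htop' : ∑ n ∈ ((R.filter fun n ↦ s ≤ zetaOrdinate n).filter
      (fun n ↦ ¬ zetaOrdinate (n + 1) - zetaOrdinate n < 2 / L)).filter
        (fun n ↦ ¬ zetaOrdinate (n + 1) - zetaOrdinate n < 1),
        (zetaOrdinate (n + 1) - zetaOrdinate n) ^ 2 ≤ 3072 * π ^ 2 * G * A * T / L := by
    refine le_trans (Finset.sum_le_sum_of_subset_of_nonneg ?_ fun n _ _ ↦ hnonneg n) htop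
    intro n hn
    simp only [Finset.mem_filter, not_lt] at hn ⊢
    exact ⟨hn.1.1.1, hn.1.1.2, by linarith [hn.2]⟩
  -- low ordinates
  have hlow' : G * (s + C₀) ≤ 4 * G * (T / L) := by
    have h1 : s + C₀ ≤ 2 * s := by linarith
    have h2 : 2 * s ≤ 4 * (T / L) := by
      rw [mul_div_assoc', le_div_iff₀ hLpos]
      nlinarith
    nlinarith
  -- `T/log T ≤ 4π N(T)/log² T`
  have hTL : T / L ≤ 4 * π * (zetaZeroCount T : ℝ) / L ^ 2 := by
    have hN := (div_le_iff₀ (by positivity)).1 (hT₈ T hT8)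
    rw [div_le_div_iff₀ hLpos (by positivity)]
    nlinarith
  have hK : 0 ≤ 4 * G + 8192 * π ^ 2 * A + 3072 * π ^ 2 * G * A := by positivity
  have hfin := mul_le_mul_of_nonneg_left hTL hK
  have e : (4 + 4 * π * (4 * G + 8192 * π ^ 2 * A + 3072 * π ^ 2 * G * A)) *
      (zetaZeroCount T : ℝ) / L ^ 2 = 4 * (zetaZeroCount T : ℝ) / L ^ 2 +
        (4 * G + 8192 * π ^ 2 * A + 3072 * π ^ 2 * G * A) *
          (4 * π * (zetaZeroCount T : ℝ) / L ^ 2) := by ring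
  rw [e]
  have e2 : (4 * G + 8192 * π ^ 2 * A + 3072 * π ^ 2 * G * A) * (T / L) =
      4 * G * (T / L) + 8192 * π ^ 2 * A * T / L + 3072 * π ^ 2 * G * A * T / L := by ring
  linarith

end SelbergFujii

/-! ### Corollaries for the named fact -/

open SelbergFujii in
/-- The upper-bound half of (9.25.2), in the uniformity `0 ≤ h ≤ 1`, from (9.25.2) as printed
(`0 ≤ h ≤ T/2`): `∫_0^T (S(t+h) − S(t))² dt ≤ (π⁻² + |A|) T log(3 + h log T)` for `T ≥ max(T₀, 2)`
(`√x ≤ x` for `x = log(3 + h log T) ≥ 1`). [cite: Titchmarsh1986, §9.25 (9.25.2)] -/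
theorem SelbergFujii.meanSquare_le_of_asymptotic
    (h252 : ∃ A : ℝ, ∃ T₀ : ℝ, ∀ T : ℝ, T₀ ≤ T → ∀ h : ℝ, 0 ≤ h → h ≤ T / 2 →
      |(∫ t in (0 : ℝ)..T, (zetaArgS (t + h) - zetaArgS t) ^ 2) -
          T * Real.log (3 + h * Real.log T) / π ^ 2| ≤
        A * (T * Real.sqrt (Real.log (3 + h * Real.log T)))) :
    ∃ A : ℝ, ∃ T₀ : ℝ, ∀ T : ℝ, T₀ ≤ T → ∀ h : ℝ, 0 ≤ h → h ≤ 1 →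
      ∫ t in (0 : ℝ)..T, (zetaArgS (t + h) - zetaArgS t) ^ 2 ≤
        A * (T * Real.log (3 + h * Real.log T)) := by
  obtain ⟨A, T₀, h252⟩ := h252
  have hπ : 3 < π := Real.pi_gt_three
  refine ⟨1 / π ^ 2 + |A|, max T₀ 2, fun T hT h hh hh1 ↦ ?_⟩
  simp only [max_le_iff] at hT
  obtain ⟨hT0, hT2⟩ := hT
  have hb := (abs_le.1 (h252 T hT0 h hh (by linarith))).2
  set x := Real.log (3 + h * Real.log T) with hx
  have hlogT : 0 ≤ Real.log T := Real.log_nonneg (by linarith)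
  have hx1 : 1 ≤ x := by
    rw [hx, ← Real.log_exp 1]
    refine Real.log_le_log (Real.exp_pos 1) ?_
    have := Real.exp_one_lt_d9
    nlinarith
  have hsqrt : Real.sqrt x ≤ x := by
    rw [Real.sqrt_le_left (by linarith)]
    nlinarith
  have hT0' : (0 : ℝ) ≤ T := by linarith
  have h1 : A * (T * Real.sqrt x) ≤ |A| * (T * x) := by
    calc A * (T * Real.sqrt x) ≤ |A| * (T * Real.sqrt x) :=
          mul_le_mul_of_nonneg_right (le_abs_self A) (by positivity)
      _ ≤ |A| * (T * x) := by gcongr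
  have e : (1 / π ^ 2 + |A|) * (T * x) = T * x / π ^ 2 + |A| * (T * x) := by ring
  rw [e]
  linarith

open SelbergFujii in
/-- **Selberg–Fujii large gaps from Fujii's (9.25.2) and (9.25.3)₂ only**: the gap second moment
(9.25.4)₂ that `selberg_fujii_large_gaps_of_moments` takes as a third hypothesis is supplied by
`SelbergFujii.gap_sq_sum_of_meanSquare` from (9.25.2). After this, the named fact
`Literature.NumberTheory.LFunctions.selberg_fujii_large_gaps` rests on exactly the same two
displayed inputs as `selberg_fujii_small_gaps_of_moments'` — Fujii's mean-square asymptotic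
(9.25.2) and fourth-moment bound (9.25.3) (`k = 2`) for `S(t + h) − S(t)`, i.e. Selberg's theory
of `S(t)`; neither is proved in the tree nor vendored as a named fact (D-0026).
[cite: Titchmarsh1986, §9.25 (9.25.2)–(9.25.5) and §9.26] -/
theorem selberg_fujii_large_gaps_of_moments'
    (h252 : ∃ A : ℝ, ∃ T₀ : ℝ, ∀ T : ℝ, T₀ ≤ T → ∀ h : ℝ, 0 ≤ h → h ≤ T / 2 →
      |(∫ t in (0 : ℝ)..T, (zetaArgS (t + h) - zetaArgS t) ^ 2) -
          T * Real.log (3 + h * Real.log T) / π ^ 2| ≤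
        A * (T * Real.sqrt (Real.log (3 + h * Real.log T))))
    (h253 : ∃ A : ℝ, ∃ T₀ : ℝ, ∀ T : ℝ, T₀ ≤ T → ∀ h : ℝ, 0 ≤ h → h ≤ T / 2 →
      ∫ t in (0 : ℝ)..T, (zetaArgS (t + h) - zetaArgS t) ^ 4 ≤
        T * (A * Real.log (3 + h * Real.log T)) ^ 2) :
    selberg_fujii_large_gaps :=
  selberg_fujii_large_gaps_of_moments h252 h253
    (gap_sq_sum_of_meanSquare (SelbergFujii.meanSquare_le_of_asymptotic h252))

open SelbergFujii in
/-- **Selberg–Fujii large gaps from the `L¹` lower bound and the mean-square upper bound for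
`S(t + h) − S(t)`**: the `L¹` bound at one scale `h ≍ M/log T` on `[T, 2T]` (hypothesis `hS`, as in
`selberg_fujii_small_gaps_of_abs_moment`) and the upper bound
`∫_0^T (S(t+h) − S(t))² dt ≤ A T log(3 + h log T)` (`0 ≤ h ≤ 1`) together give the named fact
`Literature.NumberTheory.LFunctions.selberg_fujii_large_gaps`; these two one-sided moment
bounds are the whole remaining analytic input of the large-gap half.
[cite: Titchmarsh1986, §9.25 (9.25.2), (9.25.4)–(9.25.5) and §9.26] -/
theorem selberg_fujii_large_gaps_of_abs_moment'
    (hS : ∃ M : ℕ, 1 ≤ M ∧ ∃ c₁ : ℝ, 0 < c₁ ∧ ∃ T₀ : ℝ, ∀ T : ℝ, T₀ ≤ T → ∀ h : ℝ,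
      2 * π * M ≤ h * Real.log T → h * Real.log T ≤ 4 * π * M →
        c₁ * T ≤ ∫ t in T..2 * T, |zetaArgS (t + h) - zetaArgS t|)
    (h2 : ∃ A : ℝ, ∃ T₀ : ℝ, ∀ T : ℝ, T₀ ≤ T → ∀ h : ℝ, 0 ≤ h → h ≤ 1 →
      ∫ t in (0 : ℝ)..T, (zetaArgS (t + h) - zetaArgS t) ^ 2 ≤
        A * (T * Real.log (3 + h * Real.log T))) :
    selberg_fujii_large_gaps :=
  selberg_fujii_large_gaps_of_abs_moment hS (gap_sq_sum_of_meanSquare h2)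

end Literature.NumberTheory.LFunctions

end
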